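import Mathlib
import Literature.RingTheory.LocalCohomology.CechFiniteness
import Literature.RingTheory.LocalCohomology.CechBaseChange
import Literature.AlgebraicGeometry.Resolution.RegularLocalRingsProofs
import Literature.AlgebraicGeometry.Resolution.NagataCriterion
import Literature.AlgebraicGeometry.Resolution.CohenMacaulayCatenary
import Literature.AlgebraicGeometry.Resolution.RegularLocalRingsQuotient
import Summits.Langlands.Langlands.Theorems.SkinnerWilesDefectOneReducibleOrdinaryProModularDomainComponentDim
import Summits.Langlands.Langlands.Theorems.SkinnerWilesDefectOneReducibleOrdinaryProModularConnectednessIntegralTransfer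
import Summits.Langlands.Langlands.Theorems.SkinnerWilesDefectOneReducibleOrdinaryProModularHullHypersurfacePunctured
import Summits.Langlands.Langlands.Theorems.SkinnerWilesDefectOneReducibleOrdinaryProModularCechLocalization
import Summits.Langlands.Langlands.Theorems.SkinnerWilesDefectOneReducibleOrdinaryProModularLocalizeKernelPresentation

/-!
# The local Lefschetz theorem at a prime of the reflexive hull — sub-goal (M1b) of stub (R)
# `stub_raynaudConnectedness`

Route `SkinnerWilesDefectOne`, crux `ReducibleOrdinaryProModular` (stmt-Langlands-12919), line
`fine-selmer-codimension-two`, stub (R) `stub_raynaudConnectedness` = Grothendieck's connectedness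
theorem [SGA 2 XIII 2.1]; step (M1b) of the lead's (c3) proof.  Let `S` be a regular local ring,
`D` a Noetherian domain, finite over `S`, which is a second syzygy over `S` (`0 → D → S^a → S^b` exact —
the reflexive hull of `…ReflexiveHull.lean`), `0 ≠ f ∈ D` and `𝔭 ∋ f` a prime of `D` whose contraction
`𝔮 = 𝔭 ∩ S` has `dim S_𝔮 ≥ 3` (for the hull this is `dim (D/fD)/𝔭 ≤ dim S - 3`,
`Theorems.exists_ringKrullDim_localization_under_eq`).  Then the punctured spectrum of
`D_𝔭 / f D_𝔭 ≅ (D/fD)_𝔭` is connected (`Theorems.crossing_one_localization_hypersurface_hull`, crossing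
form on the minimal primes).  This is localisation plumbing around two statements taken as
hypotheses: the depth/torsion lemma (H1b, `…CechDepthTorsion.lean`) and the algebraic local Lefschetz
theorem (G5, `…AlgebraicLefschetz.lean`):

* `S_𝔮` is regular (Serre, tree `isRegularLocalRing_localization_atPrime`) of dimension `3 + n`, with a
  regular system of parameters `y` (`exists_regular_sop` of `…HullHypersurfacePunctured.lean`);
* `A = D ⊗_S S_𝔮` is a second syzygy over `S_𝔮` (localised kernel presentation,
  `…LocalizeKernelPresentation.lean`), so (H1b) gives an `A`-regular pair `y₀, y₁` and
  `(y)^N · H²(y; A) = 0`;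
* both pass to the localisation `B = D_𝔭` of `A` (`…CechLocalization.lean`, `…CechH2Transport.lean`,
  Mathlib's `IsWeaklyRegular.of_isLocalization`), where `𝔪_B ⊆ √(y B)` because a prime of `D_𝔭` lying
  over `𝔮` is maximal (incomparability for the integral extension `S → D`,
  `Theorems.eq_maximalIdeal_localization_atPrime_of_under_le`), and `f ∈ 𝔪_B ⊆ √(y B)` kills `H²` after
  a power;
* (G5) for `B` and the isomorphism `(D/fD)_p ≅ D_𝔭 / f D_𝔭`
  (`Theorems.nonempty_ringEquiv_localization_atPrime_quotient`, tree
  `isLocalization_atPrime_localization_quotient`) give the registered statement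
  `stub_raynaudConnectedness_auxHullPuncturedLocal` (§5, binders verbatim).

No definitions are introduced; no named facts are used.

References: A. Grothendieck, SGA 2, Exp. XIII §2 [Grothendieck1968SGA2]; H. Matsumura, *Commutative Ring
Theory*, §5, Thm. 9.3, Thm. 17.4, Thm. 19.3 [Matsumura1987].
-/

set_option linter.dupNamespace false -- project-wide option (lakefile weak.linter.dupNamespace); `Summit.Langlands.Langlands` is the mandated namespace
set_option autoImplicit false

noncomputable section

namespace Summit.Langlands.Langlands.Theorems

open IsLocalRing Literature.AlgebraicGeometry.Resolution

/-! ## 1. Primes of `D_𝔭` over `𝔮 = 𝔭 ∩ S` -/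

section Radical

variable {S D : Type*} [CommRing S] [CommRing D] [Algebra S D] [Algebra.IsIntegral S D]
  (𝔭 : Ideal D) [𝔭.IsPrime]

/-- **Incomparability, localised.**  For an integral extension `S → D` and a prime `𝔭` of `D` with
contraction `𝔮 = 𝔭 ∩ S`, a prime `𝔔` of `D_𝔭` whose contraction to `S` contains `𝔮` is the maximal
ideal: its contraction `Q₀ ⊆ 𝔭` to `D` lies over `𝔮`, so `Q₀ = 𝔭` by incomparability
(Mathlib's `Ideal.IsIntegral.comap_lt_comap`), and `𝔔 = Q₀ D_𝔭 = 𝔪`. [cite: Matsumura1987, Thm. 9.3] -/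
theorem eq_maximalIdeal_localization_atPrime_of_under_le (𝔔 : Ideal (Localization.AtPrime 𝔭))
    [𝔔.IsPrime]
    (h : 𝔭.under S ≤ (𝔔.comap (algebraMap D (Localization.AtPrime 𝔭))).under S) :
    𝔔 = maximalIdeal (Localization.AtPrime 𝔭) := by
  set B := Localization.AtPrime 𝔭
  set Q₀ : Ideal D := 𝔔.comap (algebraMap D B) with hQ₀_def
  have hQ₀le : Q₀ ≤ 𝔭 := fun x hx =>
    (IsLocalization.AtPrime.to_map_mem_maximal_iff B 𝔭 x).mp
      (IsLocalRing.le_maximalIdeal (Ideal.IsPrime.ne_top inferInstance) hx)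
  have heq : Q₀ = 𝔭 := by
    by_contra hne
    have hlt : Q₀ < 𝔭 := lt_of_le_of_ne hQ₀le hne
    exact absurd h (not_le_of_gt (Ideal.IsIntegral.comap_lt_comap (R := S) hlt))
  calc 𝔔 = (𝔔.under D).map (algebraMap D B) := (IsLocalization.map_under 𝔭.primeCompl B 𝔔).symm
    _ = 𝔭.map (algebraMap D B) := by rw [Ideal.under_def, ← hQ₀_def, heq]
    _ = maximalIdeal B := Localization.AtPrime.map_eq_maximalIdeal

/-- Hence an ideal `J` of `D_𝔭` containing the image of `𝔮 = 𝔭 ∩ S` is primary to the maximal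
ideal: `𝔪_{D_𝔭} ⊆ √J` (every prime over `J` is `𝔪`). [cite: Matsumura1987, Thm. 9.3] -/
theorem maximalIdeal_localization_atPrime_le_radical {J : Ideal (Localization.AtPrime 𝔭)}
    (hJ : ∀ s ∈ 𝔭.under S, algebraMap D (Localization.AtPrime 𝔭) (algebraMap S D s) ∈ J) :
    maximalIdeal (Localization.AtPrime 𝔭) ≤ J.radical := by
  intro x hx
  rw [Ideal.radical_eq_sInf, Submodule.mem_sInf]
  rintro 𝔔 ⟨hJ𝔔, h𝔔⟩
  haveI : Ideal.IsPrime 𝔔 := h𝔔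
  have h := eq_maximalIdeal_localization_atPrime_of_under_le (S := S) 𝔭 𝔔 (fun s hs => by
    rw [Ideal.under_def, Ideal.mem_comap, Ideal.mem_comap]
    exact hJ𝔔 (hJ s hs))
  change x ∈ 𝔔
  rw [h]
  exact hx

end Radical

/-! ## 2. `(D/I)_p ≅ D_𝔭 / I D_𝔭` -/

section Iso

variable {D : Type*} [CommRing D]

/-- **Localisation commutes with quotients**: for a prime `p` of `D/I` with preimage `𝔭` in `D`,
`(D/I)_p ≅ D_𝔭 / I D_𝔭` as rings (tree `isLocalization_atPrime_localization_quotient`, transported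
along `𝔭/I = p`, and the uniqueness of localisations `IsLocalization.algEquiv`). [folklore] -/
theorem nonempty_ringEquiv_localization_atPrime_quotient (I : Ideal D) (p : Ideal (D ⧸ I))
    [p.IsPrime] :
    Nonempty (Localization.AtPrime p ≃+*
      Localization.AtPrime (p.comap (Ideal.Quotient.mk I)) ⧸
        I.map (algebraMap D (Localization.AtPrime (p.comap (Ideal.Quotient.mk I))))) := by
  set 𝔭 : Ideal D := p.comap (Ideal.Quotient.mk I) with h𝔭
  have hmap : 𝔭.map (Ideal.Quotient.mk I) = p :=
    Ideal.map_comap_of_surjective _ Ideal.Quotient.mk_surjective p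
  have hI𝔭 : I ≤ 𝔭 := fun x hx => by
    rw [h𝔭, Ideal.mem_comap, Ideal.Quotient.eq_zero_iff_mem.mpr hx]
    exact p.zero_mem
  haveI hprime : (𝔭.map (Ideal.Quotient.mk I)).IsPrime := by rw [hmap]; infer_instance
  have hloc := isLocalization_atPrime_localization_quotient I 𝔭 hI𝔭
  have hM : (𝔭.map (Ideal.Quotient.mk I)).primeCompl = p.primeCompl := by
    ext x
    change x ∉ 𝔭.map (Ideal.Quotient.mk I) ↔ x ∉ p
    rw [hmap]
  have hloc' : IsLocalization.AtPrime
      (Localization.AtPrime 𝔭 ⧸ I.map (algebraMap D (Localization.AtPrime 𝔭))) p := by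
    unfold IsLocalization.AtPrime at hloc ⊢
    rwa [hM] at hloc
  exact ⟨(IsLocalization.algEquiv p.primeCompl (Localization.AtPrime p)
    (Localization.AtPrime 𝔭 ⧸ I.map (algebraMap D (Localization.AtPrime 𝔭)))).toRingEquiv⟩

/-- The extension of a principal ideal is principal: `(f) B = (f_B)`. [folklore] -/
theorem map_span_singleton_algebraMap (B : Type*) [CommRing B] [Algebra D B] (f : D) :
    (Ideal.span {f}).map (algebraMap D B) = Ideal.span {algebraMap D B f} := by
  rw [Ideal.map_span, Set.image_singleton]

end Iso

/-! ## 3. The dimension count: `dim S_𝔮 ≥ 3` -/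

section DimCount

variable {S D : Type*} [CommRing S] [IsRegularLocalRing S] [CommRing D] [Algebra S D]
  [Algebra.IsIntegral S D]

/-- **The localised regular ring has dimension `≥ 3`.**  For `S` regular local of dimension `d`,
`S → D` integral, `p` a prime of `D/I` with preimage `𝔭` and `𝔮 = 𝔭 ∩ S`: if
`dim (D/I)/p + 1 ≤ d - 2` then `dim S_𝔮 = ht 𝔮 = d - dim S/𝔮 = d - dim D/𝔭 ≥ 3` (dimension formula in
the catenary local domain `S`, tree `isCatenaryRing_of_isRegularLocalRing` and
`height_add_ringKrullDim_quotient_eq_of_isCatenaryRing_of_isDomain`; `dim S/𝔮 = dim D/𝔭` by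
integrality, `ringKrullDim_quotient_under_eq_of_isIntegral`). [cite: Matsumura1987, §5 p. 31] -/
theorem exists_ringKrullDim_localization_under_eq (I : Ideal D) (p : Ideal (D ⧸ I)) [p.IsPrime]
    {d : ℕ} (hd : (d : WithBot ℕ∞) = ringKrullDim S)
    (hdim : ringKrullDim ((D ⧸ I) ⧸ p) + 1 ≤ ((d - 2 : ℕ) : WithBot ℕ∞)) :
    ∃ n : ℕ, ((3 + n : ℕ) : WithBot ℕ∞) =
      ringKrullDim (Localization.AtPrime ((p.comap (Ideal.Quotient.mk I)).under S)) := by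
  haveI := isDomain_of_isRegularLocalRing S
  set 𝔭 : Ideal D := p.comap (Ideal.Quotient.mk I) with h𝔭
  set 𝔮 : Ideal S := 𝔭.under S with h𝔮
  obtain ⟨d', hd'⟩ := exists_nat_cast_eq_ringKrullDim (R := Localization.AtPrime 𝔮)
  have hht : ringKrullDim (Localization.AtPrime 𝔮) = 𝔮.height :=
    IsLocalization.AtPrime.ringKrullDim_eq_height 𝔮 _
  have hform := height_add_ringKrullDim_quotient_eq_of_isCatenaryRing_of_isDomain
    (isCatenaryRing_of_isRegularLocalRing S) 𝔮
  have h1 : ringKrullDim ((D ⧸ I) ⧸ p) = ringKrullDim (D ⧸ 𝔭) :=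
    ringKrullDim_quotQuot_eq_ringKrullDim_quotient_comap I p
  have h2 : ringKrullDim (S ⧸ 𝔮) = ringKrullDim (D ⧸ 𝔭) :=
    ringKrullDim_quotient_under_eq_of_isIntegral 𝔭
  haveI : Nontrivial (S ⧸ 𝔮) :=
    Ideal.Quotient.nontrivial_iff.mpr (Ideal.IsPrime.ne_top inferInstance)
  haveI : IsLocalRing (S ⧸ 𝔮) := .of_surjective' _ Ideal.Quotient.mk_surjective
  obtain ⟨e, he⟩ := exists_nat_cast_eq_ringKrullDim (R := S ⧸ 𝔮)
  have hA : ((𝔮.height : ℕ∞) : WithBot ℕ∞) = (d' : WithBot ℕ∞) := by rw [← hht, hd']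
  have hB : ((𝔮.height : ℕ∞) : WithBot ℕ∞) + (e : WithBot ℕ∞) = (d : WithBot ℕ∞) := by
    rw [← he, hform, hd]
  rw [hA] at hB
  have hC : (e : WithBot ℕ∞) + 1 ≤ ((d - 2 : ℕ) : WithBot ℕ∞) := by
    rwa [h1, ← h2, he] at hdim
  have hB' : d' + e = d := by
    have : ((d' + e : ℕ) : WithBot ℕ∞) = (d : WithBot ℕ∞) := by push_cast; exact hB
    exact_mod_cast this
  have hC' : e + 1 ≤ d - 2 := by
    have : ((e + 1 : ℕ) : WithBot ℕ∞) ≤ ((d - 2 : ℕ) : WithBot ℕ∞) := by push_cast; exact hC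
    exact_mod_cast this
  refine ⟨d' - 3, ?_⟩
  rw [hd']
  congr 1
  omega

end DimCount

/-! ## 4. The local Lefschetz theorem at a prime of the hull -/

section Main

open RingTheory.Sequence Literature.RingTheory.LocalCohomology
open Summit.Langlands.Langlands.Cruxes.ReducibleOrdinaryProModular.FineSelmerCodimensionTwo
  (stub_raynaudConnectedness_auxH2BaseChange stub_raynaudConnectedness_auxCechLocalization
    stub_raynaudConnectedness_auxLocalizeKernelPresentation)

variable {S : Type} [CommRing S] [IsRegularLocalRing S]
variable {D : Type} [CommRing D] [IsDomain D] [IsNoetherianRing D] [Algebra S D] [Module.Finite S D]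

/-- **The punctured spectrum of `D_𝔭 / f D_𝔭` is connected** for a prime `𝔭 ∋ f` (`f ≠ 0`) of a
Noetherian domain `D`, finite over the regular local ring `S` and a second syzygy over `S`, whenever
`dim S_𝔮 = 3 + n` for `𝔮 = 𝔭 ∩ S`.  With `A = D ⊗_S S_𝔮` (a second syzygy over the regular local ring
`S_𝔮`), (H1b) gives an `A`-regular pair among a regular system of parameters `y` of `S_𝔮` and
`(y)^N H²(y; A) = 0`; both pass to the localisation `B = D_𝔭` of `A`, where `𝔪_B ⊆ √(y B)`
(incomparability) and `f ∈ 𝔪_B` is a non-zero-divisor killing `H²(y; B)` after a power; the algebraic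
local Lefschetz theorem (G5) for `B` concludes. [cite: Grothendieck1968SGA2, Exp. XIII §2] -/
theorem crossing_one_localization_hypersurface_hull
    (hH1b : ∀ (R : Type) [CommRing R] [IsNoetherianRing R] (s : ℕ) (y : Fin s → R) (x₁ x₂ x₃ : R), RingTheory.Sequence.IsRegular R [x₁, x₂, x₃] → x₁ ∈ (Ideal.span (Set.range y)).radical → x₂ ∈ (Ideal.span (Set.range y)).radical → x₃ ∈ (Ideal.span (Set.range y)).radical → ∀ (M : Type) [AddCommGroup M] [Module R M] (a b : ℕ) (Φ : M →ₗ[R] (Fin a → R)) (Ψ : (Fin a → R) →ₗ[R] (Fin b → R)), Function.Injective Φ → LinearMap.range Φ = LinearMap.ker Ψ → RingTheory.Sequence.IsWeaklyRegular M [x₁, x₂] ∧ ∃ N : ℕ, ∀ c : Literature.RingTheory.LocalCohomology.H2 (y := y) (M := M), ∀ r ∈ Ideal.span (Set.range y) ^ N, r • c = 0)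
    (hG5 : ∀ (B : Type) [CommRing B] [IsNoetherianRing B] [IsLocalRing B] (s : ℕ) (y : Fin s → B) (f : B), (∀ i, y i ∈ IsLocalRing.maximalIdeal B) → IsLocalRing.maximalIdeal B ≤ (Ideal.span (Set.range y)).radical → f ∈ IsLocalRing.maximalIdeal B → IsSMulRegular B f → (∃ x₁ x₂ : B, RingTheory.Sequence.IsRegular B [x₁, x₂] ∧ x₁ ∈ (Ideal.span (Set.range y)).radical ∧ x₂ ∈ (Ideal.span (Set.range y)).radical) → (∃ N : ℕ, ∀ c : Literature.RingTheory.LocalCohomology.H2 (y := y) (M := B), f ^ N • c = 0) → ∀ S : Set (PrimeSpectrum (B ⧸ Ideal.span {f})), (∃ C ∈ S, C.asIdeal ∈ minimalPrimes (B ⧸ Ideal.span {f})) → (∃ C ∉ S, C.asIdeal ∈ minimalPrimes (B ⧸ Ideal.span {f})) → ∃ C₁ ∈ S, ∃ C₂ ∉ S, C₁.asIdeal ∈ minimalPrimes (B ⧸ Ideal.span {f}) ∧ C₂.asIdeal ∈ minimalPrimes (B ⧸ Ideal.span {f}) ∧ (1 : WithBot ℕ∞) ≤ ringKrullDim ((B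 ⧸ Ideal.span {f}) ⧸ (C₁.asIdeal ⊔ C₂.asIdeal)))
    {a b : ℕ} (Φ : D →ₗ[S] (Fin a → S)) (Ψ : (Fin a → S) →ₗ[S] (Fin b → S))
    (hΦ : Function.Injective Φ) (hex : LinearMap.range Φ = LinearMap.ker Ψ)
    {f : D} (hf0 : f ≠ 0) (𝔭 : Ideal D) [𝔭.IsPrime] (hf𝔭 : f ∈ 𝔭) {n : ℕ}
    (hn : ((3 + n : ℕ) : WithBot ℕ∞) = ringKrullDim (Localization.AtPrime (𝔭.under S)))
    (T : Set (PrimeSpectrum (Localization.AtPrime 𝔭 ⧸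
      Ideal.span {algebraMap D (Localization.AtPrime 𝔭) f})))
    (h₁ : ∃ C ∈ T, C.asIdeal ∈ minimalPrimes (Localization.AtPrime 𝔭 ⧸
      Ideal.span {algebraMap D (Localization.AtPrime 𝔭) f}))
    (h₂ : ∃ C ∉ T, C.asIdeal ∈ minimalPrimes (Localization.AtPrime 𝔭 ⧸
      Ideal.span {algebraMap D (Localization.AtPrime 𝔭) f})) :
    ∃ C₁ ∈ T, ∃ C₂ ∉ T,
      C₁.asIdeal ∈ minimalPrimes (Localization.AtPrime 𝔭 ⧸
        Ideal.span {algebraMap D (Localization.AtPrime 𝔭) f}) ∧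
      C₂.asIdeal ∈ minimalPrimes (Localization.AtPrime 𝔭 ⧸
        Ideal.span {algebraMap D (Localization.AtPrime 𝔭) f}) ∧
      (1 : WithBot ℕ∞) ≤ ringKrullDim ((Localization.AtPrime 𝔭 ⧸
        Ideal.span {algebraMap D (Localization.AtPrime 𝔭) f}) ⧸ (C₁.asIdeal ⊔ C₂.asIdeal)) := by
  classical
  -- notation: `𝔮 = 𝔭 ∩ S`, `S𝔮 = S_𝔮`, `B = D_𝔭`, `A = D ⊗_S S_𝔮`
  let 𝔮 : Ideal S := 𝔭.under S
  let B : Type := Localization.AtPrime 𝔭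
  let S𝔮 : Type := Localization.AtPrime 𝔮
  haveI := isDomain_of_isRegularLocalRing S
  haveI : IsRegularLocalRing S𝔮 := isRegularLocalRing_localization_atPrime S 𝔮
  -- (1) a regular system of parameters `Q` of `S_𝔮`; the first three form a regular triple
  obtain ⟨Q, hQspan, hQreg⟩ := exists_regular_sop (S := S𝔮) (3 + n) hn
  have hQm : ∀ i, Q i ∈ maximalIdeal S𝔮 := fun i => by
    rw [← hQspan]; exact Ideal.subset_span ⟨i, rfl⟩
  have hsplit : List.ofFn Q = [Q (Fin.castAdd n 0), Q (Fin.castAdd n 1), Q (Fin.castAdd n 2)] ++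
      List.ofFn (fun j => Q (Fin.natAdd 3 j)) := by
    rw [List.ofFn_add]
    simp [List.ofFn_succ]
    refine ⟨rfl, rfl, rfl⟩
  have hreg3 : IsRegular S𝔮 [Q (Fin.castAdd n 0), Q (Fin.castAdd n 1), Q (Fin.castAdd n 2)] := by
    have hw :
        IsWeaklyRegular S𝔮 [Q (Fin.castAdd n 0), Q (Fin.castAdd n 1), Q (Fin.castAdd n 2)] := by
      have := hQreg.toIsWeaklyRegular
      rw [hsplit, isWeaklyRegular_append_iff] at this
      exact this.1
    refine (IsLocalRing.isRegular_iff_isWeaklyRegular_of_subset_maximalIdeal ?_).mpr hw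
    intro r hr
    simp only [List.mem_cons, List.not_mem_nil, or_false] at hr
    rcases hr with rfl | rfl | rfl <;> exact hQm _
  have hxrad : ∀ i, Q i ∈ (Ideal.span (Set.range Q)).radical := fun i =>
    Ideal.le_radical (Ideal.subset_span ⟨i, rfl⟩)
  -- (2) `A = D ⊗_S S_𝔮` is a second syzygy over `S_𝔮`
  let A : Type := Localization (Algebra.algebraMapSubmonoid D 𝔮.primeCompl)
  obtain ⟨Φ', Ψ', hΦ', hex'⟩ := stub_raynaudConnectedness_auxLocalizeKernelPresentation S
    𝔮.primeCompl S𝔮 D A (IsScalarTower.toAlgHom S D A).toLinearMap a b Φ Ψ hΦ hex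
  -- (3) the depth/torsion lemma (H1b) over `S_𝔮`
  obtain ⟨hwreg, N, hN⟩ := hH1b S𝔮 (3 + n) Q _ _ _ hreg3 (hxrad _) (hxrad _) (hxrad _) A a b Φ' Ψ'
    hΦ' hex'
  -- (4) base change `S_𝔮 → A`: `J₁ ^ N` kills `H²(y_A; A)` for `J₁ = (Q) A`
  set yA : Fin (3 + n) → A := fun i => algebraMap S𝔮 A (Q i) with hyA
  set J₁ : Ideal A := (Ideal.span (Set.range Q)).map (algebraMap S𝔮 A) with hJ₁
  have hA1 := stub_raynaudConnectedness_auxH2BaseChange S𝔮 A (3 + n) Q A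
    (Ideal.span (Set.range Q) ^ N) hN
  have hA2 : ∀ c : H2 (y := yA) (M := A), ∀ r ∈ J₁ ^ N, r • c = 0 := fun c r hr => by
    rw [hJ₁, ← Ideal.map_pow] at hr
    exact smul_eq_zero_of_mem_map (R := S𝔮) (B := A) _ hA1 hr c
  -- (5) localise the module `A` to `B = D_𝔭`, a localisation of `A`
  have hle : Algebra.algebraMapSubmonoid D 𝔮.primeCompl ≤ 𝔭.primeCompl := by
    rintro _ ⟨s, hs, rfl⟩
    exact fun h => hs h
  letI : Algebra A B := IsLocalization.localizationAlgebraOfSubmonoidLe A B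
    (Algebra.algebraMapSubmonoid D 𝔮.primeCompl) 𝔭.primeCompl hle
  haveI : IsScalarTower D A B := IsLocalization.localization_isScalarTower_of_submonoid_le A B
    (Algebra.algebraMapSubmonoid D 𝔮.primeCompl) 𝔭.primeCompl hle
  haveI hlocAB : IsLocalization (𝔭.primeCompl.map (algebraMap D A)) B :=
    IsLocalization.isLocalization_of_submonoid_le A B
      (Algebra.algebraMapSubmonoid D 𝔮.primeCompl) 𝔭.primeCompl hle
  have hB1 := stub_raynaudConnectedness_auxCechLocalization A (3 + n) yA A B
    (𝔭.primeCompl.map (algebraMap D A)) (Algebra.linearMap A B) (J₁ ^ N) hA2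
  -- (6) base change `A → B`; `y'' =` the image of `Q` in `B`
  have hB2 := stub_raynaudConnectedness_auxH2BaseChange A B (3 + n) yA B (J₁ ^ N) hB1
  let y'' : Fin (3 + n) → B := fun i => algebraMap A B (yA i)
  have htower : ∀ s : S, algebraMap A B (algebraMap S𝔮 A (algebraMap S S𝔮 s)) =
      algebraMap D B (algebraMap S D s) := fun s => by
    rw [← IsScalarTower.algebraMap_apply S S𝔮 A, IsScalarTower.algebraMap_apply S D A,
      ← IsScalarTower.algebraMap_apply D A B]
  have hspan'' : Ideal.span (Set.range y'') = J₁.map (algebraMap A B) := by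
    rw [hJ₁, Ideal.map_map, Ideal.map_span, ← Set.range_comp]
    rfl
  have hQmap : ∀ x ∈ Ideal.span (Set.range Q), algebraMap A B (algebraMap S𝔮 A x) ∈
      Ideal.span (Set.range y'') := fun x hx => by
    rw [hspan'', Ideal.map_map]
    exact Ideal.mem_map_of_mem _ hx
  -- (7) `𝔪_B ⊆ √(y'')`: `(y'') ⊇ 𝔮 B` and incomparability
  have hrad : maximalIdeal B ≤ (Ideal.span (Set.range y'')).radical := by
    refine maximalIdeal_localization_atPrime_le_radical (S := S) 𝔭 fun s hs => ?_
    rw [← htower]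
    refine hQmap _ ?_
    rw [hQspan]
    exact (IsLocalization.AtPrime.to_map_mem_maximal_iff S𝔮 𝔮 s).mpr hs
  -- (8) `y'' i ∈ 𝔪_B`; `f_B ∈ 𝔪_B` is a non-zero-divisor of the domain `B`
  have hy'' : ∀ i, y'' i ∈ maximalIdeal B := fun i => by
    have hmem : Q i ∈ 𝔮.map (algebraMap S S𝔮) := by
      rw [Localization.AtPrime.map_eq_maximalIdeal]; exact hQm i
    have hle' : (𝔮.map (algebraMap S S𝔮)).map ((algebraMap A B).comp (algebraMap S𝔮 A)) ≤
        maximalIdeal B := by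
      rw [Ideal.map_map, Ideal.map_le_iff_le_comap]
      intro s hs
      rw [Ideal.mem_comap, RingHom.comp_apply, RingHom.comp_apply, htower]
      exact (IsLocalization.AtPrime.to_map_mem_maximal_iff B 𝔭 _).mpr hs
    exact hle' (Ideal.mem_map_of_mem _ hmem)
  have hfBm : algebraMap D B f ∈ maximalIdeal B :=
    (IsLocalization.AtPrime.to_map_mem_maximal_iff B 𝔭 f).mpr hf𝔭
  have hfB0 : algebraMap D B f ≠ 0 := fun h =>
    hf0 (IsLocalization.injective B 𝔭.primeCompl_le_nonZeroDivisors (by rw [map_zero]; exact h))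
  have hfreg : IsSMulRegular B (algebraMap D B f) := (IsRegular.of_ne_zero hfB0).left.isSMulRegular
  -- (9) a power of `f_B` kills `H²(y''; B)`: `f_B ∈ 𝔪_B ⊆ √(J₁ B)` and `J₁ ^ N` kills it
  have hH2 : ∃ N' : ℕ, ∀ c : H2 (y := y'') (M := B), algebraMap D B f ^ N' • c = 0 := by
    have hf' : algebraMap D B f ∈ (J₁.map (algebraMap A B)).radical := by
      rw [← hspan'']; exact hrad hfBm
    exact exists_pow_smul_eq_zero_of_mem_radical_map (R := A) (B := B) (H := H2 (y := y'') (M := B))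
      J₁ N hB2 hf'
  -- (10) the `B`-regular pair `y''₀, y''₁` (flat base change `A → B` of the `A`-regular pair)
  have hdepth : ∃ z₁ z₂ : B, IsRegular B [z₁, z₂] ∧ z₁ ∈ (Ideal.span (Set.range y'')).radical ∧
      z₂ ∈ (Ideal.span (Set.range y'')).radical := by
    refine ⟨y'' (Fin.castAdd n 0), y'' (Fin.castAdd n 1), ?_,
      Ideal.le_radical (Ideal.subset_span ⟨_, rfl⟩), Ideal.le_radical (Ideal.subset_span ⟨_, rfl⟩)⟩
    have hwA : IsWeaklyRegular A
        ([Q (Fin.castAdd n 0), Q (Fin.castAdd n 1)].map (algebraMap S𝔮 A)) :=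
      (isWeaklyRegular_map_algebraMap_iff A A _).mpr hwreg
    have hwB := hwA.of_isLocalization B (𝔭.primeCompl.map (algebraMap D A))
    simp only [List.map_cons, List.map_nil] at hwB
    refine (IsLocalRing.isRegular_iff_isWeaklyRegular_of_subset_maximalIdeal ?_).mpr hwB
    intro r hr
    simp only [List.mem_cons, List.not_mem_nil, or_false] at hr
    rcases hr with rfl | rfl <;> exact hy'' _
  -- (11) the algebraic local Lefschetz theorem (G5) for `B`
  exact hG5 B (3 + n) y'' (algebraMap D B f) hy'' hrad hfBm hfreg hdepth hH2 T h₁ h₂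

end Main

end Summit.Langlands.Langlands.Theorems

/-! ## 5. The registered sub-goal (verbatim signature) -/

namespace Summit.Langlands.Langlands.Cruxes.ReducibleOrdinaryProModular.FineSelmerCodimensionTwo

open Summit.Langlands.Langlands.Theorems

set_option linter.overlappingInstances false in
/-- **Registered sub-goal `stub_raynaudConnectedness_auxHullPuncturedLocal` of stub (R)
`stub_raynaudConnectedness`** (c3, SGA 2 XIII 2.1 programme, step (M1b)): the algebraic local
Lefschetz theorem at the localisation of the hull `D` at a prime `𝔭 ∋ f` of small coheight
(`dim (D/fD)/𝔭 + 1 ≤ dim S - 2`, so `dim S_{𝔭 ∩ S} ≥ 3` by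
`Theorems.exists_ringKrullDim_localization_under_eq`), given the depth/torsion lemma (H1b) and the
algebraic Lefschetz theorem (G5): `Theorems.crossing_one_localization_hypersurface_hull` transported
along `(D/fD)_p ≅ D_𝔭 / f D_𝔭`. [cite: Grothendieck1968SGA2, Exp. XIII §2] -/
theorem stub_raynaudConnectedness_auxHullPuncturedLocal : (∀ (R : Type) [CommRing R] [IsNoetherianRing R] (s : ℕ) (y : Fin s → R) (x₁ x₂ x₃ : R), RingTheory.Sequence.IsRegular R [x₁, x₂, x₃] → x₁ ∈ (Ideal.span (Set.range y)).radical → x₂ ∈ (Ideal.span (Set.range y)).radical → x₃ ∈ (Ideal.span (Set.range y)).radical → ∀ (M : Type) [AddCommGroup M] [Module R M] (a b : ℕ) (Φ : M →ₗ[R] (Fin a → R)) (Ψ : (Fin a → R) →ₗ[R] (Fin b → R)), Function.Injective Φ → LinearMap.range Φ = LinearMap.ker Ψ → RingTheory.Sequence.IsWeaklyRegular M [x₁, x₂] ∧ ∃ N : ℕ, ∀ c : Literature.RingTheory.LocalCohomology.H2 (y := y) (M := M), ∀ r ∈ Ideal.span (Set.range y) ^ N, r • c = 0) → (∀ (B :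 Type) [CommRing B] [IsNoetherianRing B] [IsLocalRing B] (s : ℕ) (y : Fin s → B) (f : B), (∀ i, y i ∈ IsLocalRing.maximalIdeal B) → IsLocalRing.maximalIdeal B ≤ (Ideal.span (Set.range y)).radical → f ∈ IsLocalRing.maximalIdeal B → IsSMulRegular B f → (∃ x₁ x₂ : B, RingTheory.Sequence.IsRegular B [x₁, x₂] ∧ x₁ ∈ (Ideal.span (Set.range y)).radical ∧ x₂ ∈ (Ideal.span (Set.range y)).radical) → (∃ N : ℕ, ∀ c : Literature.RingTheory.LocalCohomology.H2 (y := y) (M := B), f ^ N • c = 0) → ∀ S : Set (PrimeSpectrum (B ⧸ Ideal.span {f})), (∃ C ∈ S, C.asIdeal ∈ minimalPrimes (B ⧸ Ideal.span {f})) → (∃ C ∉ S, C.asIdeal ∈ minimalPrimes (B ⧸ Ideal.span {f})) → ∃ C₁ ∈ S, ∃ C₂ ∉ S, C₁.asIdeal ∈ minimalPrimes (B ⧸ Ideal.span {f}) ∧ C₂.asIdeal ∈ minimalPrimes (B ⧸ Ideal.span {f}) ∧ (1 : WithBot ℕ∞) ≤ ringKrullDim ((B ⧸ Ideal.span {f})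 ⧸ (C₁.asIdeal ⊔ C₂.asIdeal))) → ∀ (S : Type) [CommRing S] [IsRegularLocalRing S] (D : Type) [CommRing D] [IsDomain D] [IsNoetherianRing D] [IsLocalRing D] [Algebra S D] [Module.Finite S D], Function.Injective (algebraMap S D) → (IsLocalRing.maximalIdeal S).map (algebraMap S D) ≤ IsLocalRing.maximalIdeal D → IsLocalRing.maximalIdeal D ≤ ((IsLocalRing.maximalIdeal S).map (algebraMap S D)).radical → ∀ (a b : ℕ) (Φ : D →ₗ[S] (Fin a → S)) (Ψ : (Fin a → S) →ₗ[S] (Fin b → S)), Function.Injective Φ → LinearMap.range Φ = LinearMap.ker Ψ → ∀ (d : ℕ), (d : WithBot ℕ∞) = ringKrullDim S → 3 ≤ d → ∀ f : D, f ≠ 0 → f ∈ IsLocalRing.maximalIdeal D → ∀ p : PrimeSpectrum (D ⧸ Ideal.span {f}), p.asIdeal.comap (Ideal.Quotient.mk (Ideal.span {f})) ≠ IsLocalRing.maximalIdeal D → ringKrullDim ((D ⧸ Ideal.span {f}) ⧸ p.asIdeal) + 1 ≤ ((d - 2 : ℕ) : WithBot ℕ∞) → ∀ T : Set (PrimeSpectrum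 (Localization.AtPrime p.asIdeal)), (∃ C ∈ T, C.asIdeal ∈ minimalPrimes (Localization.AtPrime p.asIdeal)) → (∃ C ∉ T, C.asIdeal ∈ minimalPrimes (Localization.AtPrime p.asIdeal)) → ∃ C₁ ∈ T, ∃ C₂ ∉ T, C₁.asIdeal ∈ minimalPrimes (Localization.AtPrime p.asIdeal) ∧ C₂.asIdeal ∈ minimalPrimes (Localization.AtPrime p.asIdeal) ∧ (1 : WithBot ℕ∞) ≤ ringKrullDim (Localization.AtPrime p.asIdeal ⧸ (C₁.asIdeal ⊔ C₂.asIdeal)) := by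
  intro hH1b hG5 S _ _ D _ _ _ _ _ _ _hinj _hmS _hradS a b Φ Ψ hΦ hex d hd _h3 f hf0 _hfm p _hp hdim
  obtain ⟨n, hn⟩ :=
    exists_ringKrullDim_localization_under_eq (S := S) (Ideal.span {f}) p.asIdeal hd hdim
  have hf𝔭 : f ∈ p.asIdeal.comap (Ideal.Quotient.mk (Ideal.span {f})) := by
    rw [Ideal.mem_comap, Ideal.Quotient.eq_zero_iff_mem.mpr (Ideal.mem_span_singleton_self f)]
    exact Submodule.zero_mem _
  obtain ⟨e⟩ := nonempty_ringEquiv_localization_atPrime_quotient (Ideal.span {f}) p.asIdeal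
  exact crossing_of_ringEquiv (e.trans (Ideal.quotEquivOfEq (map_span_singleton_algebraMap _ f))) 1
    (crossing_one_localization_hypersurface_hull hH1b hG5 Φ Ψ hΦ hex hf0 _ hf𝔭 hn)

end Summit.Langlands.Langlands.Cruxes.ReducibleOrdinaryProModular.FineSelmerCodimensionTwo

end
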